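import Summits.QuantumFields.BalabanUV.T4Continuum.Support.VariationalColourTaxiTowerEndClass
import Summits.QuantumFields.BalabanUV.T4Continuum.Support.VariationalVectorEndOfLeavesMin

/-!
# T⁴ programme, spine node NE2 (U1a), lane P2 — «V-COL-TAXI-END», part 4: THE END-min AT BAŁABAN's TAXI DATA — leaf-10-g3's `towerLimitRate_effV_of_leaves_min`
# (p225541: the vector END with the two `G`-binders LOCALISED at minimisers, (SLICE-min) ∕ (ONE-min) of leaf-01-g7's `VariationalAssemblySliceMin` p224582) at the
# nested product line transports of a COHERENT tower of UNITARY one-step bond operators, transport side inhabited; per-level and under the plaquette class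

NE2 formalisation swarm `b2b-balaban-t4-ne2-formalise-*`, leaf prover 04 GEN 5 (`prover-b2b-balaban-t4-ne2-formalise-leaf-04-g5-0`); register row «P2-sup» of
`t4/formal/NE2/LEAVES.md`; journal CLAIMS.log «V-COL-TAXI-END» part 4 (INTENT 2026-08-20 16:24Z).  Compositions BY NAME of leaf-10-g3's
`VariationalVectorEndOfLeavesMin.towerLimitRate_effV_of_leaves_min` (p225541) with parts 1 ∕ 2 of «V-COL-TAXI-END» (`VariationalColourTaxiTowerEnd{,Class}`, p224981 ∕ p225925:
the one-step sockets and the class arithmetic) and parts 1 ∕ 5 ∕ 10 of «V-COL-TAXI(-TOWER)»; nothing defined.  The proofs are those of parts 1 ∕ 2 with two socket lines changed.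

THE POINT.  leaf-01-g7's memo `t4/T4-EST-NE2-P2-VGF.md` and leaf-10-g3's END-min replace the slice END's global `G`-binders by their LOCALISED forms: (SLICE-min) — the gauge
slice is reachable at the stated cost only from AVERAGED FINE MINIMISERS — and (ONE-min) — leaf V-ONE only AT THE COARSE MINIMISER and INTO THE COMPOSITE FIBRE, for the FULL
fine form.  At Bałaban's taxi data nothing else changes: the structural ∕ transport sockets are parts 1 ∕ 5 ∕ 10, the smallness ∕ uniformity ∕ decay lines are part 2.
 * §0 **`taxiClassPackage`** — part 2's class glue bundled ONCE (any Hilbert fibre): level defects `a` of `Rlev k` in the class, the four per-level smallness lines,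
   `κ⁻¹γ_k ≤ ½`, `Λ_k ≤ 4·lamV d ((d−1)c) C_G⋆ c₀` — consumed by §2 and by every later taxi-data END instance;
 * §1 **`towerLimitRate_effV_taxiTower_min`** — per level, explicit smallness ∕ uniformity ∕ decay lines displayed (any `θ ∈ [0,1)`), (SLICE-min)_k ∕ (ONE-min)_k ∕ V-REG_k and
   the G-side ((GF1′)_k, Gårding_k, matrix form, `Gtr`) DISPLAYED;
 * §2 **`towerLimitRate_effV_taxiTower_min_of_class`** — the same under the scale-invariant plaquette class `(L^{k+1})²b_k ≤ c` with part 2's three polynomial smallness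
   conditions on `c`, level defects eliminated, rate `θ ∈ [L⁻¹,1)`.
WHAT IS NOT HERE (stated, not hidden): no G-side law is proved — (SLICE-min) ∕ (ONE-min) with background are leaf V-GF's OPEN content (at flat data they are leaf-01-g7's
`VariationalAssemblySliceMinFlat`, p225221); V-REG is displayed (leaf-03-g6's «V-REG WITH BACKGROUND» INTENT 16:20Z being the intended supplier for Bałaban's `projG`).

HONEST FRAMING (T4-DAG p. 1).  Composition at MODEL level (`E = ℂ`; bond operators DATA; taxi ∕ straight contours OURS; [Balaban1985BackgroundPropagators] (3.10)∕(3.15)∕(3.19),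
[Balaban1985AveragingOperations] (125) SHAPES only, no B0, c5); nothing printed is a hypothesis; no `def`, no `def … : Prop`, no `sorry`; axioms standard.  V-GF ∕ V-REG
DISPLAYED ⟹ V-END with background NOT proved; NE2 NOT proved on either road; NE3 OPEN; spine PROVED 0∕9 unchanged; rung (B)+1 finite T⁴ — NOT infinite volume, NOT mass gap,
NOT Clay.  HONEST DEPENDENCY (cell, verbatim): continuum YM on T⁴ ⇐ BetaPertH ∧ nine spine estimates (0/9 proved); BetaPertH ⇐ (D1) ∧ (D4) ∧ CAP+tail; G-an2-4 gates
asym, D1 and NE2/3/4.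
-/

noncomputable section

namespace Summit.QuantumFields.BalabanUV.T4Continuum.VariationalColourTaxiTransport

open Finset
open scoped Matrix ComplexOrder BigOperators
open Literature.MathematicalPhysics.QuantumFieldTheory.Balaban1983to89.B5Prop11Plancherel (Tor fine unitVec)
open Literature.Analysis.Complex (qform)
open Summit.QuantumFields.BalabanUV.T4Continuum.VariationalTransfer (blockSpin)
open Summit.QuantumFields.BalabanUV.T4Continuum.VariationalColourFederbush (norm_le_one_of_mem_unitary)
open Summit.QuantumFields.BalabanUV.T4Continuum.VariationalColourTower (Rtrv)
open Summit.QuantumFields.BalabanUV.T4Continuum.VariationalVectorFederbush (lineT)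
open Summit.QuantumFields.BalabanUV.T4Continuum.CovariantAveragingTower (TowerLimitRate)
open Summit.QuantumFields.BalabanUV.T4Continuum.VectorBlockTrialForm (nsqV nsqV_nonneg QvL roughV kappaV)
open Summit.QuantumFields.BalabanUV.T4Continuum.VariationalVectorForm (ScV SfV qWV qVV lamV lamV_nonneg ScV_nonneg)
open Summit.QuantumFields.BalabanUV.T4Continuum.VariationalVectorEffective (unc effV)
open Summit.QuantumFields.BalabanUV.T4Continuum.VariationalVectorTower (Gtr QmL SfV_eq_transport)
open Summit.QuantumFields.BalabanUV.T4Continuum.VariationalVectorEndOfLeaves (eV ePV nonneg_of_qform)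
open Summit.QuantumFields.BalabanUV.T4Continuum.VariationalVectorEndOfLeavesMin (towerLimitRate_effV_of_leaves_min)

variable {d : ℕ}

/-! ## §0 The class package: every per-level line of the taxi-data ENDs from the scale-invariant plaquette class, ONCE -/

section Package

variable {H : Type*} [NormedAddCommGroup H] [InnerProductSpace ℂ H] [CompleteSpace H]
variable (L : ℕ) [NeZero L] (M : Fin d → ℕ) [hM : ∀ μ, NeZero (M μ)]

/-- **THE CLASS PACKAGE** (part 2's glue, bundled once for every taxi-data END): from `2 ≤ L`, `1 ≤ d`, UNITARY one-step bond operators with `(L^{k+1})²b_k ≤ c` and the three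
polynomial smallness conditions on `c`, and (GF1′) constants with `C_G,k ≤ C_G⋆`, `(L^k)²C₀,k ≤ c₀`: level plaquette defects `a` of `Rlev k` in the same class (`a_0 = L²b_0`,
`a_{k+1} = b_k`), the four per-level smallness lines of parts 5 ∕ 10 (`κ⁻¹γ_k < 1` — indeed `≤ ½` —, `2d(L^k(d−1)(L^k−1)a_k)² ≤ ½`, `64·S_k² ≤ 1`, `κ_L⁻¹·3(d−1)L(L−1)b_k < 1`) and the
k-UNIFORM V-UB bound `Λ_k ≤ 4·lamV d ((d−1)c) C_G⋆ c₀`. [folklore] -/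
theorem taxiClassPackage (hL : 2 ≤ L) (hd : 1 ≤ d) {R' : (k : ℕ) → Tor (fine L (fine (L ^ k) M)) → Fin d → (H →L[ℂ] H)}
    (hU : ∀ k x μ, R' k x μ ∈ unitary (H →L[ℂ] H)) {b : ℕ → ℝ} {c : ℝ}
    (hb : ∀ k x κ ι, ‖R' k x κ * R' k (x + unitVec (fine L (fine (L ^ k) M)) κ) ι - R' k x ι * R' k (x + unitVec (fine L (fine (L ^ k) M)) ι) κ‖ ≤ b k)
    (hbc : ∀ k, (((L ^ (k + 1) : ℕ)) : ℝ) ^ 2 * b k ≤ c)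
    (hsm1 : 60 * (6 : ℝ) ^ (d - 1) * ((2 * ((((d - 1 : ℕ) : ℝ) + (d : ℝ) * d)) + 3 * ((d - 1 : ℕ) : ℝ)) * c) ≤ 1 / 2)
    (hsm2 : 2 * (d : ℝ) * ((((d - 1 : ℕ) : ℝ)) * c) ^ 2 ≤ 1 / 2) (hsm3 : 64 * (2 * ((((d - 1 : ℕ) : ℝ) + (d : ℝ) * d) * c)) ^ 2 ≤ 1)
    {CG C₀ : ℕ → ℝ} {CGs c₀ : ℝ} (hCG : ∀ k, 0 ≤ CG k) (hCGs : ∀ k, CG k ≤ CGs) (hC₀ : ∀ k, 0 ≤ C₀ k) (hC₀c : ∀ k, (((L ^ k : ℕ)) : ℝ) ^ 2 * C₀ k ≤ c₀) :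
    ∃ a : ℕ → ℝ, (∀ k, 0 ≤ a k) ∧
      (∀ k x κ ι, ‖Rlev L M R' k x κ * Rlev L M R' k (x + unitVec (fine (L ^ k) M) κ) ι - Rlev L M R' k x ι * Rlev L M R' k (x + unitVec (fine (L ^ k) M) ι) κ‖ ≤ a k) ∧
      (∀ k, (((L ^ k : ℕ)) : ℝ) ^ 2 * a k ≤ c) ∧
      (∀ k, (kappaV d (L ^ k))⁻¹ * ((∑ q ∈ Finset.range k, ((((d - 1 : ℕ) : ℝ) + (d : ℝ) * d) * (((L : ℝ) * ((L ^ q - 1 : ℕ) : ℝ) * ((L - 1 : ℕ) : ℝ)) * b q)))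
        + 3 * (((d - 1 : ℕ) : ℝ) * (L ^ k : ℕ) * ((L ^ k - 1 : ℕ) : ℝ) * a k)) ≤ 1 / 2) ∧
      (∀ k, 2 * (d : ℝ) * ((((L ^ k : ℕ) : ℝ)) * (((d - 1 : ℕ) : ℝ) * ((L ^ k - 1 : ℕ) : ℝ) * a k)) ^ 2 ≤ 1 / 2) ∧
      (∀ k, 64 * (∑ q ∈ Finset.range k, ((((d - 1 : ℕ) : ℝ) + (d : ℝ) * d) * (((L : ℝ) * ((L ^ q - 1 : ℕ) : ℝ) * ((L - 1 : ℕ) : ℝ)) * b q))) ^ 2 ≤ 1) ∧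
      (∀ k, (kappaV d L)⁻¹ * (3 * (((d - 1 : ℕ) : ℝ) * L * ((L - 1 : ℕ) : ℝ) * b k)) < 1) ∧
      (∀ k, lamV d ((L ^ k : ℕ) * (((d - 1 : ℕ) : ℝ) * ((L ^ k - 1 : ℕ) : ℝ) * a k)) (CG k) (((L ^ k : ℕ) : ℝ) ^ 2 * C₀ k)
        / (1 - (kappaV d (L ^ k))⁻¹ * ((∑ q ∈ Finset.range k, ((((d - 1 : ℕ) : ℝ) + (d : ℝ) * d) * (((L : ℝ) * ((L ^ q - 1 : ℕ) : ℝ) * ((L - 1 : ℕ) : ℝ)) * b q)))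
            + 3 * (((d - 1 : ℕ) : ℝ) * (L ^ k : ℕ) * ((L ^ k - 1 : ℕ) : ℝ) * a k))) ^ 2 ≤ 4 * lamV d (((d - 1 : ℕ) : ℝ) * c) CGs c₀) := by
  have hL2 : (2 : ℝ) ≤ L := by exact_mod_cast hL
  have hR' : ∀ k x μ, ‖R' k x μ‖ ≤ 1 := fun k x μ => norm_le_one_of_mem_unitary (hU k x μ)
  have hb0 : ∀ k, 0 ≤ b k := fun k => (norm_nonneg _).trans (hb k 0 ⟨0, hd⟩ ⟨0, hd⟩)
  -- the level-`k` plaquette defects in the same class (part 10 §1b)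
  obtain ⟨a, ha0, ha, hac⟩ : ∃ a : ℕ → ℝ, (∀ k, 0 ≤ a k) ∧
      (∀ k x κ ι, ‖Rlev L M R' k x κ * Rlev L M R' k (x + unitVec (fine (L ^ k) M) κ) ι - Rlev L M R' k x ι * Rlev L M R' k (x + unitVec (fine (L ^ k) M) ι) κ‖
        ≤ a k) ∧ (∀ k, (((L ^ k : ℕ)) : ℝ) ^ 2 * a k ≤ c) := by
    refine ⟨fun k => Nat.rec ((L : ℝ) * L * b 0) (fun q _ => b q) k, ?_, ?_, ?_⟩
    · rintro (_ | q)
      · exact (by have := hb0 0; positivity : 0 ≤ (L : ℝ) * L * b 0)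
      · exact hb0 q
    · rintro (_ | q) x κ ι
      · exact Rlev_plaq_zero L M hb (hR' 0) x κ ι
      · exact Rlev_plaq_succ L M hb q x κ ι
    · rintro (_ | q)
      · have h := hbc 0
        simp only [zero_add, pow_one] at h
        show (((L ^ 0 : ℕ)) : ℝ) ^ 2 * ((L : ℝ) * L * b 0) ≤ c
        simp only [pow_zero, Nat.cast_one, one_pow, one_mul]
        nlinarith
      · exact hbc q
  have hS := sumDefect_le_of_class (d := d) L hL hb0 hbc
  have hS0 : ∀ k, 0 ≤ ∑ q ∈ Finset.range k, ((((d - 1 : ℕ) : ℝ) + (d : ℝ) * d) * (((L : ℝ) * ((L ^ q - 1 : ℕ) : ℝ) * ((L - 1 : ℕ) : ℝ)) * b q)) :=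
    fun k => Finset.sum_nonneg fun q _ => by have := hb0 q; positivity
  have hT : ∀ k, 3 * (((d - 1 : ℕ) : ℝ) * (L ^ k : ℕ) * ((L ^ k - 1 : ℕ) : ℝ) * a k) ≤ 3 * (((d - 1 : ℕ) : ℝ) * c) :=
    fun k => levelDefect_le_of_class (d := d) L k (ha0 k) (hac k)
  have hT0 : ∀ k, 0 ≤ 3 * (((d - 1 : ℕ) : ℝ) * (L ^ k : ℕ) * ((L ^ k - 1 : ℕ) : ℝ) * a k) := fun k => by have := ha0 k; positivity
  have hLk : ∀ k : ℕ, 0 < L ^ k := fun k => pow_pos (by omega) k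
  have hκγ : ∀ k, (kappaV d (L ^ k))⁻¹ * ((∑ q ∈ Finset.range k, ((((d - 1 : ℕ) : ℝ) + (d : ℝ) * d) * (((L : ℝ) * ((L ^ q - 1 : ℕ) : ℝ) * ((L - 1 : ℕ) : ℝ)) * b q)))
      + 3 * (((d - 1 : ℕ) : ℝ) * (L ^ k : ℕ) * ((L ^ k - 1 : ℕ) : ℝ) * a k)) ≤ 1 / 2 := fun k => by
    have h1 := mul_le_mul (kappaV_inv_le (d := d) hd (hLk k)) (show _ ≤ (2 * ((((d - 1 : ℕ) : ℝ) + (d : ℝ) * d)) + 3 * ((d - 1 : ℕ) : ℝ)) * c by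
      linarith [hS k, hT k]) (add_nonneg (hS0 k) (hT0 k)) (by positivity)
    linarith
  refine ⟨a, ha0, ha, hac, hκγ, fun k => ?_, fun k => ?_, fun k => ?_, fun k => ?_⟩
  · have h := blockDefect_le_of_class (d := d) L k (ha0 k) (hac k)
    have h0 : 0 ≤ ((L ^ k : ℕ) : ℝ) * (((d - 1 : ℕ) : ℝ) * ((L ^ k - 1 : ℕ) : ℝ) * a k) := by have := ha0 k; positivity
    have h2 := pow_le_pow_left₀ h0 h 2
    nlinarith [Nat.cast_nonneg (α := ℝ) d]
  · have h2 := pow_le_pow_left₀ (hS0 k) (hS k) 2; linarith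
  · have hLm : ((L - 1 : ℕ) : ℝ) ≤ L := by rw [Nat.cast_sub (by omega), Nat.cast_one]; linarith
    have h2 : (L : ℝ) * L * b k ≤ c := by
      have : (L : ℝ) * L ≤ (((L ^ (k + 1) : ℕ)) : ℝ) ^ 2 := by
        push_cast
        have : (L : ℝ) ≤ (L : ℝ) ^ (k + 1) := le_self_pow₀ (by linarith) (by omega)
        nlinarith
      linarith [mul_le_mul_of_nonneg_right this (hb0 k), hbc k]
    have h1 : (L : ℝ) * ((L - 1 : ℕ) : ℝ) * b k ≤ c := by
      nlinarith [mul_le_mul_of_nonneg_left hLm (by have := hb0 k; positivity : 0 ≤ (L : ℝ) * b k)]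
    have hc0 : 0 ≤ c := le_trans (by have := hb0 k; positivity) h2
    have h5 : 3 * (((d - 1 : ℕ) : ℝ) * L * ((L - 1 : ℕ) : ℝ) * b k) ≤ (2 * ((((d - 1 : ℕ) : ℝ) + (d : ℝ) * d)) + 3 * ((d - 1 : ℕ) : ℝ)) * c := by
      have hA : 3 * (((d - 1 : ℕ) : ℝ) * L * ((L - 1 : ℕ) : ℝ) * b k) ≤ 3 * (((d - 1 : ℕ) : ℝ) * c) := by
        nlinarith [mul_le_mul_of_nonneg_left h1 (Nat.cast_nonneg (α := ℝ) (d - 1))]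
      have hB : 3 * (((d - 1 : ℕ) : ℝ) * c) ≤ (2 * ((((d - 1 : ℕ) : ℝ) + (d : ℝ) * d)) + 3 * ((d - 1 : ℕ) : ℝ)) * c := by
        nlinarith [Nat.cast_nonneg (α := ℝ) (d - 1), Nat.cast_nonneg (α := ℝ) d, hc0]
      exact hA.trans hB
    have h7 := mul_le_mul (kappaV_inv_le (d := d) hd (show 0 < L by omega)) h5 (by have := hb0 k; positivity) (by positivity)
    linarith
  · exact LambdaV_le_of_class (d := d) (by have := ha0 k; positivity) (blockDefect_le_of_class (d := d) L k (ha0 k) (hac k)) (hCG k) (hCGs k)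
      (by have := hC₀ k; positivity) (hC₀c k) (hκγ k)

end Package

/-! ## §1 The END-min at taxi data, per-level lines displayed -/

section End

variable (L : ℕ) [NeZero L] (M : Fin d → ℕ) [hM : ∀ μ, NeZero (M μ)]
variable {R' : (k : ℕ) → Tor (fine L (fine (L ^ k) M)) → Fin d → (ℂ →L[ℂ] ℂ)}
variable (Gm : (k : ℕ) → Matrix (Tor (fine (L ^ k) M) × Fin d) (Tor (fine (L ^ k) M) × Fin d) ℂ)
variable (G : (k : ℕ) → (Tor (fine (L ^ k) M) → Fin d → ℂ) → ℝ)
variable (G' : (k : ℕ) → (Tor (fine L (fine (L ^ k) M)) → Fin d → ℂ) → ℝ)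

/-- **THE END-min AT BAŁABAN's TAXI DATA** — leaf-10-g3's `towerLimitRate_effV_of_leaves_min` (p225541) at `T k := nestLv k`, `R k := Rlev k`,
`T′ k := lineT (taxiTv (R′ k)) (R′ k)`: as part 1's `towerLimitRate_effV_taxiTower_slice` (same DATA, same discharged structural ∕ transport sockets `hTcomp`∕`hRtr`∕`hT′1`∕
`hUBc`∕`hUBf`∕`hPc`∕`hPf`∕`hFEDcurl`, same displayed G-side, smallness ∕ uniformity ∕ decay lines and V-REG) with the two `G`-binders LOCALISED: **(SLICE-min)_k** at averaged
fine minimisers and **(ONE-min)_k** at coarse minimisers into the composite fibre, in p224582's letters at the taxi carriers; no `hsurj₁`.  Same constant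
`eV Λ⋆ C_P⋆ c_δ + c_σ′·(Λ⋆ + eV Λ⋆ C_P⋆ c_δ) + c_σ·(C_P⋆(Λ⋆+1)) + ePV Λ⋆ C_P⋆ C_R⋆ c_ε c_δ′`, `C_P⋆ = max(40κ⋆, 64 + 40κ′⋆)` (`aa` = the END's parameter `a`). [folklore] -/
theorem towerLimitRate_effV_taxiTower_min (hd : 1 ≤ d) (hM2 : ∀ μ, 1 < M μ)
    -- the one-step bond data: unitary, plaquette defects (one-step `b`, level `a`), coherent
    (hU : ∀ k x μ, R' k x μ ∈ unitary (ℂ →L[ℂ] ℂ)) {b a : ℕ → ℝ}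
    (hb : ∀ k x κ ι, ‖R' k x κ * R' k (x + unitVec (fine L (fine (L ^ k) M)) κ) ι - R' k x ι * R' k (x + unitVec (fine L (fine (L ^ k) M)) ι) κ‖ ≤ b k)
    (ha0 : ∀ k, 0 ≤ a k)
    (ha : ∀ k x κ ι, ‖Rlev L M R' k x κ * Rlev L M R' k (x + unitVec (fine (L ^ k) M) κ) ι - Rlev L M R' k x ι * Rlev L M R' k (x + unitVec (fine (L ^ k) M) ι) κ‖ ≤ a k)
    (hcoh : ∀ k, coarseTv L (fine (L ^ (k + 1)) M) (R' (k + 1)) = Rtrv (L ^ k) L M (R' k))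
    -- the G-side (leaf V-GF, DISPLAYED): matrix form, transport identity, (GF1′), the Gårding half, the gauge SLICE
    (hGm : ∀ k, (Gm k).PosSemidef) (hG : ∀ k W, G k W = qform (Gm k) (unc W)) (hGtr : ∀ k, G (k + 1) = Gtr (L ^ k) L M (G' k))
    {CG C₀ κg κg' : ℕ → ℝ} {κs κs' : ℝ} (hCG : ∀ k, 0 ≤ CG k) (hC₀ : ∀ k, 0 ≤ C₀ k) (hκg' : ∀ k, 0 ≤ κg' k) (hκs : ∀ k, κg k ≤ κs) (hκs' : ∀ k, κg' k ≤ κs')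
    (hGF : ∀ k W, G k W ≤ CG k * roughV (L ^ k) M (Rlev L M R' k) W + C₀ k * nsqV (fine (L ^ k) M) W)
    (hGar : ∀ k W, ((((L ^ k : ℕ) : ℝ)) ^ d)⁻¹ * ((((L ^ k : ℕ) : ℝ)) ^ 2 * roughV (L ^ k) M (Rlev L M R' k) W)
      ≤ κg k * ScV (L ^ k) M (Rlev L M R' k) (G k) W + κg' k * nsqV M (QvL (L ^ k) M (nestLv L M R' k) W))
    (σ σ' : ℕ → ℝ) {cσ cσ' : ℝ} (hσ : ∀ k, 0 ≤ σ k) (hσ' : ∀ k, 0 ≤ σ' k)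
    (hsliceMin : ∀ k (φ : Tor M → Fin d → ℂ) (g₀ : Tor (fine L (fine (L ^ k) M)) → Fin d → ℂ),
      QvL (L ^ k) M (nestLv L M R' k) (QvL L (fine (L ^ k) M) (lineT L (fine (L ^ k) M) (taxiTv L (fine (L ^ k) M) (R' k)) (R' k)) g₀) = φ →
      (∀ W', QvL (L ^ k) M (nestLv L M R' k) (QvL L (fine (L ^ k) M) (lineT L (fine (L ^ k) M) (taxiTv L (fine (L ^ k) M) (R' k)) (R' k)) W') = φ →
        SfV (L ^ k) L M (R' k) (G' k) g₀ ≤ SfV (L ^ k) L M (R' k) (G' k) W') →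
      ∃ Ws, QvL (L ^ k) M (nestLv L M R' k) Ws = φ ∧
        ScV (L ^ k) M (Rlev L M R' k) (G k) Ws
          ≤ ScV (L ^ k) M (Rlev L M R' k) (fun _ => 0) (QvL L (fine (L ^ k) M) (lineT L (fine (L ^ k) M) (taxiTv L (fine (L ^ k) M) (R' k)) (R' k)) g₀)
            + σ' k * ScV (L ^ k) M (Rlev L M R' k) (fun _ => 0) (QvL L (fine (L ^ k) M) (lineT L (fine (L ^ k) M) (taxiTv L (fine (L ^ k) M) (R' k)) (R' k)) g₀)
            + σ k * qWV (L ^ k) M (QvL L (fine (L ^ k) M) (lineT L (fine (L ^ k) M) (taxiTv L (fine (L ^ k) M) (R' k)) (R' k)) g₀))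
    -- the per-level smallness lines of parts 5 ∕ 10 (discharged under the plaquette class in the companion file)
    (hcUB : ∀ k, (kappaV d (L ^ k))⁻¹ * ((∑ q ∈ Finset.range k, ((((d - 1 : ℕ) : ℝ) + (d : ℝ) * d) * (((L : ℝ) * ((L ^ q - 1 : ℕ) : ℝ) * ((L - 1 : ℕ) : ℝ)) * b q)))
        + 3 * (((d - 1 : ℕ) : ℝ) * (L ^ k : ℕ) * ((L ^ k - 1 : ℕ) : ℝ) * a k)) < 1)
    (hsmallP : ∀ k, 2 * (d : ℝ) * ((((L ^ k : ℕ) : ℝ)) * (((d - 1 : ℕ) : ℝ) * ((L ^ k - 1 : ℕ) : ℝ) * a k)) ^ 2 ≤ 1 / 2)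
    (hγs : ∀ k, 64 * (∑ q ∈ Finset.range k, ((((d - 1 : ℕ) : ℝ) + (d : ℝ) * d) * (((L : ℝ) * ((L ^ q - 1 : ℕ) : ℝ) * ((L - 1 : ℕ) : ℝ)) * b q))) ^ 2 ≤ 1)
    -- rate, uniformity of the explicit V-UB constant, decay of the explicit curl-Federbush parameter and of the slice costs
    {aa : ℝ} (haa : 0 < aa) {θ Λs cδ : ℝ} (hθ : 0 ≤ θ) (hθ1 : θ < 1)
    (hΛs : ∀ k, lamV d ((L ^ k : ℕ) * (((d - 1 : ℕ) : ℝ) * ((L ^ k - 1 : ℕ) : ℝ) * a k)) (CG k) (((L ^ k : ℕ) : ℝ) ^ 2 * C₀ k)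
      / (1 - (kappaV d (L ^ k))⁻¹ * ((∑ q ∈ Finset.range k, ((((d - 1 : ℕ) : ℝ) + (d : ℝ) * d) * (((L : ℝ) * ((L ^ q - 1 : ℕ) : ℝ) * ((L - 1 : ℕ) : ℝ)) * b q)))
          + 3 * (((d - 1 : ℕ) : ℝ) * (L ^ k : ℕ) * ((L ^ k - 1 : ℕ) : ℝ) * a k))) ^ 2 ≤ Λs)
    (hδθ : ∀ k, (d : ℝ) * ((((L ^ k : ℕ)) : ℝ) * (2 * (((d - 1 : ℕ) : ℝ) * L * ((L - 1 : ℕ) : ℝ) * b k + L * L * b k) + 2 * L * (L * L * b k))) ≤ cδ * θ ^ k)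
    (hσθ : ∀ k, σ k ≤ cσ * θ ^ k) (hσ'θ : ∀ k, σ' k ≤ cσ' * θ ^ k)
    -- leaf V-ONE for the FULL fine form and leaf V-REG (DISPLAYED)
    (CR ε₁ δ' : ℕ → ℝ) {CRs cε cδ' : ℝ} (hCR : ∀ k, 0 ≤ CR k) (hCRs : ∀ k, CR k ≤ CRs) (hε₁ : ∀ k, 0 ≤ ε₁ k) (hδ' : ∀ k, 0 ≤ δ' k)
    (hεθ : ∀ k, ε₁ k ≤ cε * θ ^ k) (hδ'θ : ∀ k, δ' k ≤ cδ' * θ ^ k)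
    {ρV : (k : ℕ) → (Tor (fine (L ^ k) M) → Fin d → ℂ) → ℝ} (hρ0 : ∀ k W, 0 ≤ ρV k W)
    (hONEm : ∀ k (φ : Tor M → Fin d → ℂ) (W₀ : Tor (fine (L ^ k) M) → Fin d → ℂ), QvL (L ^ k) M (nestLv L M R' k) W₀ = φ →
      (∀ W, QvL (L ^ k) M (nestLv L M R' k) W = φ → ScV (L ^ k) M (Rlev L M R' k) (G k) W₀ ≤ ScV (L ^ k) M (Rlev L M R' k) (G k) W) →
      ∃ g, QvL (L ^ k) M (nestLv L M R' k) (QvL L (fine (L ^ k) M) (lineT L (fine (L ^ k) M) (taxiTv L (fine (L ^ k) M) (R' k)) (R' k)) g) = φ ∧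
        SfV (L ^ k) L M (R' k) (G' k) g ≤ (Real.sqrt (ScV (L ^ k) M (Rlev L M R' k) (G k) W₀ + ε₁ k * ρV k W₀) + δ' k * Real.sqrt (qWV (L ^ k) M W₀)) ^ 2)
    (hREG : ∀ k (φ : Tor M → Fin d → ℂ) W, QvL (L ^ k) M (nestLv L M R' k) W = φ →
      (∀ W₂, QvL (L ^ k) M (nestLv L M R' k) W₂ = φ → ScV (L ^ k) M (Rlev L M R' k) (G k) W ≤ ScV (L ^ k) M (Rlev L M R' k) (G k) W₂) →
      ρV k W ≤ CR k * (ScV (L ^ k) M (Rlev L M R' k) (G k) W + nsqV M φ)) :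
    TowerLimitRate (ι := fun _ => Tor M × Fin d) (fun _ => (1 : Matrix (Tor M × Fin d) (Tor M × Fin d) ℂ)) 1
      (fun k => effV (L ^ k) M (Rlev L M R' k) (Gm k) (QmL (L ^ k) M (nestLv L M R' k)) aa)
      (eV Λs (max (40 * κs) (64 + 40 * κs')) cδ + cσ' * (Λs + eV Λs (max (40 * κs) (64 + 40 * κs')) cδ)
        + cσ * (max (40 * κs) (64 + 40 * κs') * (Λs + 1)) + ePV Λs (max (40 * κs) (64 + 40 * κs')) CRs cε cδ') θ := by
  -- (GF0) at every level from the matrix form; at level `k+1` read through `Gtr`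
  have hG0 : ∀ k W, 0 ≤ G k W := fun k => nonneg_of_qform (L ^ k) M (hGm k) (hG k)
  have hG0tr : ∀ k W, 0 ≤ Gtr (L ^ k) L M (G' k) W := fun k W => by rw [← hGtr k]; exact hG0 (k + 1) W
  have hGFtr : ∀ k W, Gtr (L ^ k) L M (G' k) W ≤ CG (k + 1) * roughV (L ^ (k + 1)) M (Rlev L M R' (k + 1)) W + C₀ (k + 1) * nsqV (fine (L ^ (k + 1)) M) W :=
    fun k W => by rw [← hGtr k]; exact hGF (k + 1) W
  have hGartr : ∀ k W, ((((L ^ (k + 1) : ℕ) : ℝ)) ^ d)⁻¹ * ((((L ^ (k + 1) : ℕ) : ℝ)) ^ 2 * roughV (L ^ (k + 1)) M (Rlev L M R' (k + 1)) W)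
      ≤ κg (k + 1) * ScV (L ^ (k + 1)) M (Rlev L M R' (k + 1)) (Gtr (L ^ k) L M (G' k)) W
        + κg' (k + 1) * nsqV M (QvL (L ^ (k + 1)) M (nestLv L M R' (k + 1)) W) := fun k W => by rw [← hGtr k]; exact hGar (k + 1) W
  have hR' : ∀ k x μ, ‖R' k x μ‖ ≤ 1 := fun k x μ => norm_le_one_of_mem_unitary (hU k x μ)
  have hb0 : ∀ k, 0 ≤ b k := fun k => (norm_nonneg _).trans (hb k 0 ⟨0, hd⟩ ⟨0, hd⟩)
  -- the explicit V-UB constants `Λ_k` and their nonnegativity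
  set Λ : ℕ → ℝ := fun k => lamV d ((L ^ k : ℕ) * (((d - 1 : ℕ) : ℝ) * ((L ^ k - 1 : ℕ) : ℝ) * a k)) (CG k) (((L ^ k : ℕ) : ℝ) ^ 2 * C₀ k)
      / (1 - (kappaV d (L ^ k))⁻¹ * ((∑ q ∈ Finset.range k, ((((d - 1 : ℕ) : ℝ) + (d : ℝ) * d) * (((L : ℝ) * ((L ^ q - 1 : ℕ) : ℝ) * ((L - 1 : ℕ) : ℝ)) * b q)))
          + 3 * (((d - 1 : ℕ) : ℝ) * (L ^ k : ℕ) * ((L ^ k - 1 : ℕ) : ℝ) * a k))) ^ 2 with hΛdef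
  have hΛ0 : ∀ k, 0 ≤ Λ k := fun k => div_nonneg (lamV_nonneg (hCG k) (by have := hC₀ k; positivity)) (sq_nonneg _)
  have hΛs0 : 0 ≤ Λs := (hΛ0 0).trans (hΛs 0)
  -- the uniform V-P constant
  set CPs : ℝ := max (40 * κs) (64 + 40 * κs') with hCPs
  have hCPk : ∀ k, max (40 * κg k) (64 + 40 * κg' k) ≤ CPs := fun k => max_le_max (by linarith [hκs k]) (by linarith [hκs' k])
  have hCPk0 : ∀ k, 0 ≤ max (40 * κg k) (64 + 40 * κg' k) := fun k => le_max_of_le_right (by linarith [hκg' k])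
  have hCPs0 : 0 ≤ CPs := (hCPk0 0).trans (hCPk 0)
  -- leaf V-UB at both levels (parts 10 ∕ §1), weakened to the uniform constant
  have hUBc : ∀ k (φ : Tor M → Fin d → ℂ), ∃ W, QvL (L ^ k) M (nestLv L M R' k) W = φ ∧ ScV (L ^ k) M (Rlev L M R' k) (G k) W ≤ Λs * nsqV M φ :=
    fun k φ => by
    obtain ⟨W, hW, hS⟩ := exists_ubV_nestLv_ScV L M hU hb hcoh k (ha0 k) (ha k) hd (hcUB k) (hCG k) (hC₀ k) (hGF k) φ
    exact ⟨W, hW, hS.trans (mul_le_mul_of_nonneg_right (hΛs k) (nsqV_nonneg M φ))⟩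
  have hUBf : ∀ k (φ : Tor M → Fin d → ℂ), ∃ W', QvL (L ^ k) M (nestLv L M R' k)
      (QvL L (fine (L ^ k) M) (lineT L (fine (L ^ k) M) (taxiTv L (fine (L ^ k) M) (R' k)) (R' k)) W') = φ ∧
      SfV (L ^ k) L M (R' k) (G' k) W' ≤ Λs * nsqV M φ := fun k φ => by
    obtain ⟨W', hW', hS⟩ := exists_ubV_nestLv_SfV L M hU hb hcoh hd k (ha0 (k + 1)) (ha (k + 1)) (hcUB (k + 1)) (hCG (k + 1)) (hC₀ (k + 1)) (hGFtr k) φ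
    exact ⟨W', hW', hS.trans (mul_le_mul_of_nonneg_right (hΛs (k + 1)) (nsqV_nonneg M φ))⟩
  -- leaf V-P at both levels modulo the Gårding halves (parts 10 ∕ §1), weakened to the uniform constant
  have hPc : ∀ k W, qWV (L ^ k) M W ≤ CPs * (ScV (L ^ k) M (Rlev L M R' k) (G k) W + nsqV M (QvL (L ^ k) M (nestLv L M R' k) W)) := fun k W => by
    have h := qWV_le_nestLv_of_garding L M hU hb hcoh hM2 k (ha k) (hsmallP k) (hγs k) (hG0 k) (hGar k) W
    exact h.trans (mul_le_mul_of_nonneg_right (hCPk k) (add_nonneg (ScV_nonneg (L ^ k) M _ (hG0 k) W) (nsqV_nonneg M _)))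
  have hPf : ∀ k W', qVV (L ^ k) L M W' ≤ CPs * (SfV (L ^ k) L M (R' k) (G' k) W'
      + nsqV M (QvL (L ^ k) M (nestLv L M R' k) (QvL L (fine (L ^ k) M) (lineT L (fine (L ^ k) M) (taxiTv L (fine (L ^ k) M) (R' k)) (R' k)) W'))) :=
    fun k W' => by
    have h := qVV_le_nestLv_of_garding L M hU hb hcoh hM2 k (ha (k + 1)) (hsmallP (k + 1)) (hγs (k + 1)) (hG0tr k) (hGartr k) W'
    refine h.trans (mul_le_mul_of_nonneg_right (hCPk (k + 1)) (add_nonneg ?_ (nsqV_nonneg M _)))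
    rw [SfV_eq_transport]
    exact ScV_nonneg (L ^ k * L) M _ (hG0tr k) _
  -- the END of leaf-10-g3, fed
  exact towerLimitRate_effV_of_leaves_min L M (Rlev L M R') R' Gm G G' (nestLv L M R')
    (fun k => lineT L (fine (L ^ k) M) (taxiTv L (fine (L ^ k) M) (R' k)) (R' k)) hGm hG (fun k => rfl) (fun k => rfl) hGtr
    (fun k y j t μ => norm_lineT_taxi_le_one (L ^ k) L M (hR' k) y j t μ) haa
    (fun _ => Λs) (fun _ => CPs) CR
    (fun k => (d : ℝ) * ((((L ^ k : ℕ)) : ℝ) * (2 * (((d - 1 : ℕ) : ℝ) * L * ((L - 1 : ℕ) : ℝ) * b k + L * L * b k) + 2 * L * (L * L * b k))))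
    ε₁ δ' σ σ' (fun _ => hΛs0) (fun _ => le_rfl) (fun _ => hCPs0) (fun _ => le_rfl) hCR hCRs
    (fun k => by have := hb0 k; positivity) hε₁ hδ' hσ hσ' hθ hθ1 hδθ hεθ hδ'θ hσθ hσ'θ hρ0 hUBc hUBf hPc hPf
    (fun k W' => ScV_QvL_nestLv_le_curl L M hU hb hcoh k (hb0 k) W') hsliceMin hONEm hREG


end End

/-! ## §2 The END-min at taxi data under the scale-invariant plaquette class -/

section EndClass

variable (L : ℕ) [NeZero L] (M : Fin d → ℕ) [hM : ∀ μ, NeZero (M μ)]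
variable {R' : (k : ℕ) → Tor (fine L (fine (L ^ k) M)) → Fin d → (ℂ →L[ℂ] ℂ)}
variable (Gm : (k : ℕ) → Matrix (Tor (fine (L ^ k) M) × Fin d) (Tor (fine (L ^ k) M) × Fin d) ℂ)
variable (G : (k : ℕ) → (Tor (fine (L ^ k) M) → Fin d → ℂ) → ℝ)
variable (G' : (k : ℕ) → (Tor (fine L (fine (L ^ k) M)) → Fin d → ℂ) → ℝ)

/-- **THE END-min AT BAŁABAN's TAXI DATA UNDER THE SCALE-INVARIANT PLAQUETTE CLASS** — part 2's `towerLimitRate_effV_taxiTower_slice_of_class` with the two `G`-binders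
LOCALISED ((SLICE-min)_k, (ONE-min)_k); everything else (DATA, class `(L^{k+1})²b_k ≤ c`, the three polynomial smallness conditions on `c`, the displayed G-side and V-REG,
`Λ⋆ = 4·lamV d ((d−1)c) C_G⋆ c₀`, `C_P⋆`, `c_δ = 2d(dc + Lc)`, rate `θ ∈ [L⁻¹,1)`) VERBATIM. [folklore] -/
theorem towerLimitRate_effV_taxiTower_min_of_class (hL : 2 ≤ L) (hd : 1 ≤ d) (hM2 : ∀ μ, 1 < M μ)
    -- the one-step bond data: unitary, plaquette class, coherent
    (hU : ∀ k x μ, R' k x μ ∈ unitary (ℂ →L[ℂ] ℂ)) {b : ℕ → ℝ} {c : ℝ}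
    (hb : ∀ k x κ ι, ‖R' k x κ * R' k (x + unitVec (fine L (fine (L ^ k) M)) κ) ι - R' k x ι * R' k (x + unitVec (fine L (fine (L ^ k) M)) ι) κ‖ ≤ b k)
    (hbc : ∀ k, (((L ^ (k + 1) : ℕ)) : ℝ) ^ 2 * b k ≤ c)
    (hcoh : ∀ k, coarseTv L (fine (L ^ (k + 1)) M) (R' (k + 1)) = Rtrv (L ^ k) L M (R' k))
    -- the polynomial smallness of the class constant
    (hsm1 : 60 * (6 : ℝ) ^ (d - 1) * ((2 * ((((d - 1 : ℕ) : ℝ) + (d : ℝ) * d)) + 3 * ((d - 1 : ℕ) : ℝ)) * c) ≤ 1 / 2)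
    (hsm2 : 2 * (d : ℝ) * ((((d - 1 : ℕ) : ℝ)) * c) ^ 2 ≤ 1 / 2) (hsm3 : 64 * (2 * ((((d - 1 : ℕ) : ℝ) + (d : ℝ) * d) * c)) ^ 2 ≤ 1)
    -- the G-side (leaf V-GF, DISPLAYED): matrix form, transport identity, (GF1′) in the class, the Gårding half, the gauge SLICE with decaying costs
    (hGm : ∀ k, (Gm k).PosSemidef) (hG : ∀ k W, G k W = qform (Gm k) (unc W)) (hGtr : ∀ k, G (k + 1) = Gtr (L ^ k) L M (G' k))
    {CG C₀ κg κg' : ℕ → ℝ} {CGs c₀ κs κs' : ℝ} (hCG : ∀ k, 0 ≤ CG k) (hCGs : ∀ k, CG k ≤ CGs) (hC₀ : ∀ k, 0 ≤ C₀ k)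
    (hC₀c : ∀ k, (((L ^ k : ℕ)) : ℝ) ^ 2 * C₀ k ≤ c₀) (hκg' : ∀ k, 0 ≤ κg' k) (hκs : ∀ k, κg k ≤ κs) (hκs' : ∀ k, κg' k ≤ κs')
    (hGF : ∀ k W, G k W ≤ CG k * roughV (L ^ k) M (Rlev L M R' k) W + C₀ k * nsqV (fine (L ^ k) M) W)
    (hGar : ∀ k W, ((((L ^ k : ℕ) : ℝ)) ^ d)⁻¹ * ((((L ^ k : ℕ) : ℝ)) ^ 2 * roughV (L ^ k) M (Rlev L M R' k) W)
      ≤ κg k * ScV (L ^ k) M (Rlev L M R' k) (G k) W + κg' k * nsqV M (QvL (L ^ k) M (nestLv L M R' k) W))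
    (σ σ' : ℕ → ℝ) {cσ cσ' : ℝ} (hσ : ∀ k, 0 ≤ σ k) (hσ' : ∀ k, 0 ≤ σ' k)
    (hsliceMin : ∀ k (φ : Tor M → Fin d → ℂ) (g₀ : Tor (fine L (fine (L ^ k) M)) → Fin d → ℂ),
      QvL (L ^ k) M (nestLv L M R' k) (QvL L (fine (L ^ k) M) (lineT L (fine (L ^ k) M) (taxiTv L (fine (L ^ k) M) (R' k)) (R' k)) g₀) = φ →
      (∀ W', QvL (L ^ k) M (nestLv L M R' k) (QvL L (fine (L ^ k) M) (lineT L (fine (L ^ k) M) (taxiTv L (fine (L ^ k) M) (R' k)) (R' k)) W') = φ →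
        SfV (L ^ k) L M (R' k) (G' k) g₀ ≤ SfV (L ^ k) L M (R' k) (G' k) W') →
      ∃ Ws, QvL (L ^ k) M (nestLv L M R' k) Ws = φ ∧
        ScV (L ^ k) M (Rlev L M R' k) (G k) Ws
          ≤ ScV (L ^ k) M (Rlev L M R' k) (fun _ => 0) (QvL L (fine (L ^ k) M) (lineT L (fine (L ^ k) M) (taxiTv L (fine (L ^ k) M) (R' k)) (R' k)) g₀)
            + σ' k * ScV (L ^ k) M (Rlev L M R' k) (fun _ => 0) (QvL L (fine (L ^ k) M) (lineT L (fine (L ^ k) M) (taxiTv L (fine (L ^ k) M) (R' k)) (R' k)) g₀)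
            + σ k * qWV (L ^ k) M (QvL L (fine (L ^ k) M) (lineT L (fine (L ^ k) M) (taxiTv L (fine (L ^ k) M) (R' k)) (R' k)) g₀))
    -- the rate and the decay of the slice costs
    {aa : ℝ} (haa : 0 < aa) {θ : ℝ} (hθL : (L : ℝ)⁻¹ ≤ θ) (hθ1 : θ < 1) (hσθ : ∀ k, σ k ≤ cσ * θ ^ k) (hσ'θ : ∀ k, σ' k ≤ cσ' * θ ^ k)
    -- leaf V-ONE for the FULL fine form and leaf V-REG (DISPLAYED)
    (CR ε₁ δ' : ℕ → ℝ) {CRs cε cδ' : ℝ} (hCR : ∀ k, 0 ≤ CR k) (hCRs : ∀ k, CR k ≤ CRs) (hε₁ : ∀ k, 0 ≤ ε₁ k) (hδ' : ∀ k, 0 ≤ δ' k)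
    (hεθ : ∀ k, ε₁ k ≤ cε * θ ^ k) (hδ'θ : ∀ k, δ' k ≤ cδ' * θ ^ k)
    {ρV : (k : ℕ) → (Tor (fine (L ^ k) M) → Fin d → ℂ) → ℝ} (hρ0 : ∀ k W, 0 ≤ ρV k W)
    (hONEm : ∀ k (φ : Tor M → Fin d → ℂ) (W₀ : Tor (fine (L ^ k) M) → Fin d → ℂ), QvL (L ^ k) M (nestLv L M R' k) W₀ = φ →
      (∀ W, QvL (L ^ k) M (nestLv L M R' k) W = φ → ScV (L ^ k) M (Rlev L M R' k) (G k) W₀ ≤ ScV (L ^ k) M (Rlev L M R' k) (G k) W) →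
      ∃ g, QvL (L ^ k) M (nestLv L M R' k) (QvL L (fine (L ^ k) M) (lineT L (fine (L ^ k) M) (taxiTv L (fine (L ^ k) M) (R' k)) (R' k)) g) = φ ∧
        SfV (L ^ k) L M (R' k) (G' k) g ≤ (Real.sqrt (ScV (L ^ k) M (Rlev L M R' k) (G k) W₀ + ε₁ k * ρV k W₀) + δ' k * Real.sqrt (qWV (L ^ k) M W₀)) ^ 2)
    (hREG : ∀ k (φ : Tor M → Fin d → ℂ) W, QvL (L ^ k) M (nestLv L M R' k) W = φ →
      (∀ W₂, QvL (L ^ k) M (nestLv L M R' k) W₂ = φ → ScV (L ^ k) M (Rlev L M R' k) (G k) W ≤ ScV (L ^ k) M (Rlev L M R' k) (G k) W₂) →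
      ρV k W ≤ CR k * (ScV (L ^ k) M (Rlev L M R' k) (G k) W + nsqV M φ)) :
    TowerLimitRate (ι := fun _ => Tor M × Fin d) (fun _ => (1 : Matrix (Tor M × Fin d) (Tor M × Fin d) ℂ)) 1
      (fun k => effV (L ^ k) M (Rlev L M R' k) (Gm k) (QmL (L ^ k) M (nestLv L M R' k)) aa)
      (eV (4 * lamV d (((d - 1 : ℕ) : ℝ) * c) CGs c₀) (max (40 * κs) (64 + 40 * κs')) (2 * d * ((d : ℝ) * c + L * c))
        + cσ' * (4 * lamV d (((d - 1 : ℕ) : ℝ) * c) CGs c₀ + eV (4 * lamV d (((d - 1 : ℕ) : ℝ) * c) CGs c₀) (max (40 * κs) (64 + 40 * κs')) (2 * d * ((d : ℝ) * c + L * c)))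
        + cσ * (max (40 * κs) (64 + 40 * κs') * (4 * lamV d (((d - 1 : ℕ) : ℝ) * c) CGs c₀ + 1))
        + ePV (4 * lamV d (((d - 1 : ℕ) : ℝ) * c) CGs c₀) (max (40 * κs) (64 + 40 * κs')) CRs cε cδ') θ := by
  have hθ0 : 0 ≤ θ := le_trans (by positivity) hθL
  have hb0 : ∀ k, 0 ≤ b k := fun k => (norm_nonneg _).trans (hb k 0 ⟨0, hd⟩ ⟨0, hd⟩)
  obtain ⟨a, ha0, ha, -, hκγ, hsmallP, hγs, -, hΛk⟩ := taxiClassPackage L M hL hd hU hb hbc hsm1 hsm2 hsm3 hCG hCGs hC₀ hC₀c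
  exact towerLimitRate_effV_taxiTower_min L M Gm G G' hd hM2 hU hb ha0 ha hcoh hGm hG hGtr hCG hC₀ hκg' hκs hκs' hGF hGar σ σ' hσ hσ' hsliceMin
    (fun k => lt_of_le_of_lt (hκγ k) (by norm_num)) hsmallP hγs haa hθ0 hθ1 hΛk
    (fun k => deltaCurl_le_of_class (d := d) L hL hd k (hb0 k) (hbc k) hθL) hσθ hσ'θ CR ε₁ δ' hCR hCRs hε₁ hδ' hεθ hδ'θ hρ0 hONEm hREG

end EndClass

end Summit.QuantumFields.BalabanUV.T4Continuum.VariationalColourTaxiTransport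

end
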